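import Literature.RepresentationTheory.HeisenbergGroup.SchrodingerConjugateTorusSphericalCoeff
import Literature.RepresentationTheory.HeisenbergGroup.SchrodingerL2Unitary
import HarnessLib

/-!
# Ramified test vectors for a Darboux-conjugate scalar torus in the Schrödinger model

C. Mœglin, M.-F. Vignéras, J.-L. Waldspurger, *Correspondances de Howe sur un corps p-adique*, LNM 1291 (1987), Chap. 2 II.1,
II.6; A. Weil, Acta Math. 111 (1964), Chap. I n° 13; J.-S. Li, J. reine angew. Math. 428 (1992), §5 p. 206 (the local integrals at
the finitely many bad places are made non-zero by a choice of test vector).  Sequel of `SchrodingerConjugateTorusSphericalCoeff`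
(the UNRAMIFIED spherical coefficients); here NO unramifiedness is assumed (`ψ` of any conductor, `γ ∈ Sp(W, A_T)` arbitrary).

For a family of implementers `φ_z` (`z ∈ Z`, any index type) of the conjugate scalar torus `γ⁻¹ m(t_z · 1) γ` in the Schrödinger
model `ρ_T` of `𝒮(F^ι)` and an `L²`-isometric implementer `Γ` of `γ`, the vectors `Φ_n := Γ⁻¹ 1_{1 + (𝔭^n)^ι}` (`n ≥ 1`; `1` the
all-ones vector) satisfy:
* `⟨Φ_n, Φ_n⟩ = μ^ι((𝔭^n)^ι)`;
* SUPPORT: `⟨φ_z Φ_n, Φ_n⟩ = 0` unless `t_z ∈ 1 + 𝔭^n`;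
* EIGEN: `φ_z Φ_n = c_z Φ_n` for `t_z ∈ 1 + 𝔭^n`, with `c_z` the uniqueness-of-implementers scalar `φ_z = c_z Γ⁻¹ L_{t_z} Γ`
  (INDEPENDENT of `n`).
Main: `exists_ramifiedTestVector`.  Consumed at the split RAMIFIED places of [Li1992 (27)] (`Li1992/RallisLocalFactorSplitRamified`).

KERNEL only: theorems, no definition, no named fact, no `sorry`.

## References
* [MoeglinVignerasWaldspurger1987] C. Mœglin, M.-F. Vignéras, J.-L. Waldspurger, LNM 1291 (1987), Chap. 2 II.1 (A)–(B), II.6.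
* [Weil1964] A. Weil, Acta Math. 111 (1964), Chap. I n° 13.
* [Li1992] J.-S. Li, J. reine angew. Math. 428 (1992), §5 p. 206.
* [BushnellHenniart2006] C. Bushnell, G. Henniart, *The local Langlands conjecture for GL(2)* (2006), §1.1 (`U^n = 1 + 𝔭^n`).
-/

set_option autoImplicit false

noncomputable section

namespace Literature.RepresentationTheory.HeisenbergGroup

open _root_.MeasureTheory Matrix ValuativeRel
open Literature.NumberTheory.Automorphic Literature.NumberTheory.Automorphic.SchwartzBruhat
open Literature.NumberTheory.GaloisRepresentations.IsNonarchimedeanLocalField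
open SymplecticMatrix
open scoped NNReal ENNReal ComplexConjugate

/-! ## §1 The unit filtration `1 + 𝔭^n` (`n ≥ 1`) -/

section UnitFiltration

variable {F : Type*} [Field F] [ValuativeRel F] [TopologicalSpace F] [IsNonarchimedeanLocalField F]

/-- `(q⁻¹)^n < 1` for `n ≥ 1`. [cite: BushnellHenniart2006, §1.1] -/
theorem inv_residueFieldCard_zpow_lt_one {n : ℤ} (hn : 1 ≤ n) : ((residueFieldCard F : ℝ≥0)⁻¹) ^ n < 1 :=
  lt_of_le_of_lt (by simpa only [zpow_one] using
    zpow_le_zpow_right_of_le_one₀ (inv_residueFieldCard_pos (F := F)) inv_residueFieldCard_lt_one.le hn)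
    inv_residueFieldCard_lt_one

/-- **`1 + 𝔭^n ⊆ 𝒪^×`** (`n ≥ 1`): `|t|_F = 1` if `|t - 1|_F ≤ q^{-n}`. [cite: BushnellHenniart2006, §1.1] -/
theorem normAbs_eq_one_of_sub_one_mem_primePowBall {n : ℤ} (hn : 1 ≤ n) {t : F} (ht : t - 1 ∈ primePowBall F n) :
    normAbs F t = 1 := by
  have h1 : normAbs F (t - 1) < 1 := lt_of_le_of_lt ht (inv_residueFieldCard_zpow_lt_one hn)
  refine le_antisymm ?_ ?_
  · have h := normAbs_add_le_max (t - 1) (1 : F)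
    rw [sub_add_cancel, map_one] at h
    exact h.trans (max_le h1.le le_rfl)
  · by_contra hlt
    rw [not_le] at hlt
    have h := normAbs_add_le_max (-(t - 1)) t
    rw [show -(t - 1) + t = 1 by ring, map_one, normAbs_neg] at h
    exact absurd (h.trans_lt (max_lt h1 hlt)) (lt_irrefl 1)

/-- `t ≠ 0` for `t ∈ 1 + 𝔭^n`, `n ≥ 1`. [cite: BushnellHenniart2006, §1.1] -/
theorem ne_zero_of_sub_one_mem_primePowBall {n : ℤ} (hn : 1 ≤ n) {t : F} (ht : t - 1 ∈ primePowBall F n) : t ≠ 0 := by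
  intro h0
  have h := normAbs_eq_one_of_sub_one_mem_primePowBall hn ht
  rw [h0, map_zero] at h
  exact zero_ne_one h

/-- **`1 + 𝔭^n` is stable under `u ↦ t⁻¹ u` for `t ∈ 1 + 𝔭^n`** (`n ≥ 1`): `t⁻¹ u ∈ 1 + 𝔭^n ↔ u ∈ 1 + 𝔭^n`.
[cite: BushnellHenniart2006, §1.1] -/
theorem inv_mul_sub_one_mem_primePowBall_iff {n : ℤ} (hn : 1 ≤ n) {t : F} (ht : t - 1 ∈ primePowBall F n) (u : F) :
    t⁻¹ * u - 1 ∈ primePowBall F n ↔ u - 1 ∈ primePowBall F n := by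
  have ht1 := normAbs_eq_one_of_sub_one_mem_primePowBall hn ht
  have ht0 := ne_zero_of_sub_one_mem_primePowBall hn ht
  have hkey : t⁻¹ * u - 1 = t⁻¹ * (u - t) := by field_simp
  have hnorm : normAbs F (t⁻¹ * u - 1) = normAbs F (u - t) := by
    rw [hkey, map_mul, map_inv₀, ht1, inv_one, one_mul]
  constructor
  · intro h
    have h' : u - t ∈ primePowBall F n := by rw [mem_primePowBall_iff, ← hnorm]; exact h
    have : u - 1 = (u - t) + (t - 1) := by ring
    rw [this]
    exact add_mem_primePowBall h' ht
  · intro h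
    have h' : u - t ∈ primePowBall F n := by
      have : u - t = (u - 1) + -(t - 1) := by ring
      rw [this]
      exact add_mem_primePowBall h (neg_mem_primePowBall ht)
    rw [mem_primePowBall_iff, hnorm]
    exact h'

/-- **support computation**: if `u ∈ 1 + 𝔭^n` and `t⁻¹ u ∈ 1 + 𝔭^n` (`n ≥ 1`, `t ≠ 0`) then `t ∈ 1 + 𝔭^n`.
[cite: BushnellHenniart2006, §1.1] -/
theorem sub_one_mem_primePowBall_of_inv_mul {n : ℤ} (hn : 1 ≤ n) {t : F} (ht0 : t ≠ 0) {u : F}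
    (hu : u - 1 ∈ primePowBall F n) (htu : t⁻¹ * u - 1 ∈ primePowBall F n) : t - 1 ∈ primePowBall F n := by
  have hu1 := normAbs_eq_one_of_sub_one_mem_primePowBall hn hu
  have htu1 := normAbs_eq_one_of_sub_one_mem_primePowBall hn htu
  have ht1 : normAbs F t = 1 := by
    rw [map_mul, map_inv₀, hu1, mul_one, inv_eq_one] at htu1
    exact htu1
  have hkey : t - 1 = (u - 1) + -(t * (t⁻¹ * u - 1)) := by field_simp; ring
  rw [hkey]
  refine add_mem_primePowBall hu (neg_mem_primePowBall ?_)
  rw [mem_primePowBall_iff, map_mul, ht1, one_mul]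
  exact htu

end UnitFiltration

/-! ## §2 The coset-ball vectors `1_{1 + (𝔭^n)^ι}` and the scalar Levi operators -/

section CosetBall

variable {F : Type*} [Field F] [ValuativeRel F] [TopologicalSpace F] [IsNonarchimedeanLocalField F]
  {ι : Type*} [Fintype ι] [DecidableEq ι] (T : Matrix ι ι F) (hT : IsUnit T.det)
  {ψ : AddChar F Circle} (hl : IsLocallyConstant (⇑ψ : F → Circle))
  (hbT : ∀ y : ι → F, Continuous fun u : ι → F => Matrix.toLinearMap₂' F T u y)

omit [ValuativeRel F] [IsNonarchimedeanLocalField F] in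
/-- `x ↦ a x` is continuous on `F^ι`. [folklore] -/
private theorem glEquiv_continuous [IsTopologicalRing F] (a : GL ι F) : Continuous (glEquiv a) :=
  ((glEquiv a : (ι → F) ≃ₗ[F] (ι → F)) : (ι → F) →ₗ[F] (ι → F)).continuous_on_pi

omit [ValuativeRel F] [IsNonarchimedeanLocalField F] in
/-- `x ↦ a⁻¹ x` is continuous on `F^ι`. [folklore] -/
private theorem glEquiv_symm_continuous [IsTopologicalRing F] (a : GL ι F) : Continuous (glEquiv a).symm :=
  (((glEquiv a).symm : (ι → F) ≃ₗ[F] (ι → F)) : (ι → F) →ₗ[F] (ι → F)).continuous_on_pi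

/-- **the coset-ball vector**: the Schrödinger translate `ρ_T((-1, 0), 0) 1_{(𝔭^n)^ι}` is the characteristic function of
`1 + (𝔭^n)^ι = {u | u_i - 1 ∈ 𝔭^n ∀ i}`. [cite: MoeglinVignerasWaldspurger1987, Chap. 2 I.4 Exemple (1)] -/
theorem coe_schrodingerSB_negOne_piBallSB (n : ℤ) :
    ((schrodingerSB (Matrix.toLinearMap₂' F T) ψ hl hbT ⟨(-(fun _ : ι => (1 : F)), 0), 0⟩ (piBallSB F ι n) :
        SchwartzBruhat (ι → F)) : (ι → F) → ℂ) =
      {u : ι → F | ∀ i, u i - 1 ∈ primePowBall F n}.indicator fun _ => (1 : ℂ) := by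
  funext u
  rw [schrodingerSB_apply, map_zero, zero_add, AddChar.map_zero_eq_one, Circle.coe_one, one_mul, coe_piBallSB]
  have hmem : u + -(fun _ : ι => (1 : F)) ∈ piPrimePowBall F ι n ↔ u ∈ {u : ι → F | ∀ i, u i - 1 ∈ primePowBall F n} := by
    rw [mem_piPrimePowBall_iff, Set.mem_setOf_eq]
    refine forall_congr' fun i => ?_
    rw [Pi.add_apply, Pi.neg_apply, ← sub_eq_add_neg]
  by_cases hu : u ∈ {u : ι → F | ∀ i, u i - 1 ∈ primePowBall F n}
  · rw [Set.indicator_of_mem hu, Set.indicator_of_mem (hmem.2 hu)]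
  · rw [Set.indicator_of_notMem hu, Set.indicator_of_notMem (mt hmem.1 hu)]

/-- **the scalar Levi operator `L_{t·1}` fixes `1_{1 + (𝔭^n)^ι}` for `t ∈ 1 + 𝔭^n`** (`n ≥ 1`): `t⁻¹ (1 + (𝔭^n)^ι) = 1 + (𝔭^n)^ι`.
[cite: Weil1964, Chap. I n° 13, p. 160; BushnellHenniart2006, §1.1] -/
theorem leviEquivSB_scalar_apply_eq_self_of_sub_one_mem {n : ℤ} (hn : 1 ≤ n) {t : F} (ht : t - 1 ∈ primePowBall F n)
    {a₀ : GL ι F} (ha₀ : (a₀ : Matrix ι ι F) = t • (1 : Matrix ι ι F))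
    (h₁ : Continuous (glEquiv a₀)) (h₂ : Continuous (glEquiv a₀).symm) (Ψ : SchwartzBruhat (ι → F))
    (hΨ : ((Ψ : SchwartzBruhat (ι → F)) : (ι → F) → ℂ) = {u : ι → F | ∀ i, u i - 1 ∈ primePowBall F n}.indicator fun _ => (1 : ℂ)) :
    leviEquivSB (glEquiv a₀) h₁ h₂ Ψ = Ψ := by
  have ht0 := ne_zero_of_sub_one_mem_primePowBall hn ht
  apply Subtype.ext
  funext u
  have h := coe_zpow_leviEquivSB_scalar_apply ht0 ha₀ 1 Ψ u
  rw [zpow_one, zpow_one] at h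
  rw [h, hΨ]
  have hmem : t⁻¹ • u ∈ {u : ι → F | ∀ i, u i - 1 ∈ primePowBall F n} ↔ u ∈ {u : ι → F | ∀ i, u i - 1 ∈ primePowBall F n} := by
    simp only [Set.mem_setOf_eq, Pi.smul_apply, smul_eq_mul]
    exact forall_congr' fun i => inv_mul_sub_one_mem_primePowBall_iff hn ht (u i)
  by_cases hu : u ∈ {u : ι → F | ∀ i, u i - 1 ∈ primePowBall F n}
  · rw [Set.indicator_of_mem hu, Set.indicator_of_mem (hmem.2 hu)]
  · rw [Set.indicator_of_notMem hu, Set.indicator_of_notMem (mt hmem.1 hu)]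

/-- **support of the coefficient**: for `t ∉ 1 + 𝔭^n` (`n ≥ 1`, `t ≠ 0`, `ι ≠ ∅`) the functions `L_{t·1} 1_{1 + (𝔭^n)^ι}` and
`1_{1 + (𝔭^n)^ι}` have disjoint supports: `(L_{t·1} Ψ)(u) conj Ψ(u) = 0` for every `u`. [cite: Li1992, §5 p. 206; BushnellHenniart2006, §1.1] -/
theorem leviEquivSB_scalar_apply_mul_conj_eq_zero [Nonempty ι] {n : ℤ} (hn : 1 ≤ n) {t : F} (ht0 : t ≠ 0)
    (ht : t - 1 ∉ primePowBall F n) {a₀ : GL ι F} (ha₀ : (a₀ : Matrix ι ι F) = t • (1 : Matrix ι ι F))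
    (h₁ : Continuous (glEquiv a₀)) (h₂ : Continuous (glEquiv a₀).symm) (Ψ : SchwartzBruhat (ι → F))
    (hΨ : ((Ψ : SchwartzBruhat (ι → F)) : (ι → F) → ℂ) = {u : ι → F | ∀ i, u i - 1 ∈ primePowBall F n}.indicator fun _ => (1 : ℂ))
    (u : ι → F) :
    ((leviEquivSB (glEquiv a₀) h₁ h₂ Ψ : SchwartzBruhat (ι → F)) :
        (ι → F) → ℂ) u * conj (((Ψ : SchwartzBruhat (ι → F)) : (ι → F) → ℂ) u) = 0 := by
  have h := coe_zpow_leviEquivSB_scalar_apply ht0 ha₀ 1 Ψ u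
  rw [zpow_one, zpow_one] at h
  rw [h, hΨ]
  by_cases hu : u ∈ {u : ι → F | ∀ i, u i - 1 ∈ primePowBall F n}
  · have htu : t⁻¹ • u ∉ {u : ι → F | ∀ i, u i - 1 ∈ primePowBall F n} := by
      intro htu
      obtain ⟨i⟩ := ‹Nonempty ι›
      have h1 : t⁻¹ * u i - 1 ∈ primePowBall F n := by
        have := htu i
        rwa [Pi.smul_apply, smul_eq_mul] at this
      exact ht (sub_one_mem_primePowBall_of_inv_mul hn ht0 (hu i) h1)
    rw [Set.indicator_of_notMem htu, zero_mul]
  · rw [Set.indicator_of_notMem hu, map_zero, mul_zero]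

end CosetBall

/-! ## §3 The ramified test vectors -/

section RamifiedTestVector

variable {F : Type*} [Field F] [ValuativeRel F] [TopologicalSpace F] [IsNonarchimedeanLocalField F]
  {ι : Type*} [Fintype ι] [DecidableEq ι] [Invertible (2 : F)] (T : Matrix ι ι F) (hT : IsUnit T.det)
  {ψ : AddChar F Circle} (hl : IsLocallyConstant (⇑ψ : F → Circle))
  (hbT : ∀ y : ι → F, Continuous fun u : ι → F => Matrix.toLinearMap₂' F T u y)
  [MeasurableSpace F] [BorelSpace F] (μ : Measure F) [μ.IsAddHaarMeasure]

include hT in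
/-- **RAMIFIED TEST VECTORS FOR A DARBOUX-CONJUGATE SCALAR TORUS.**  Let `ρ_T` be the Schrödinger model of `𝒮(F^ι)` (`ψ` continuous
non-trivial of ANY conductor, `ι ≠ ∅`), `γ ∈ Sp(W, A_T)` ARBITRARY, and `φ_z` (`z ∈ Z`) implementers of the conjugate scalar torus elements
`γ⁻¹ m(t_z · 1) γ` (`t_z ≠ 0`).  Then there are vectors `Φ_n ∈ 𝒮(F^ι)` (`n ∈ ℤ`) and scalars `c_z ∈ ℂ` such that for every `n ≥ 1`:
`∫ Φ_n conj Φ_n dμ^ι = μ^ι((𝔭^n)^ι)`; `∫ (φ_z Φ_n) conj Φ_n dμ^ι = 0` whenever `t_z ∉ 1 + 𝔭^n`; and `φ_z Φ_n = c_z Φ_n` whenever `t_z ∈ 1 + 𝔭^n`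
(`Φ_n = Γ⁻¹ 1_{1 + (𝔭^n)^ι}` for an `L²`-isometric implementer `Γ` of `γ`; `c_z` from `φ_z = c_z Γ⁻¹ L_{t_z·1} Γ`, uniqueness of implementers).
[cite: MoeglinVignerasWaldspurger1987, Chap. 2 II.1 (A)–(B), II.6] [cite: Weil1964, Chap. I n° 13] [cite: Li1992, §5 p. 206] -/
theorem exists_ramifiedTestVector [Nonempty ι] (hψ : ψ.IsContinuousNontrivial)
    (γ : symplecticGroup (polar (Matrix.toLinearMap₂' F T))) {Z : Type*}
    (φ : Z → (SchwartzBruhat (ι → F) ≃ₗ[ℂ] SchwartzBruhat (ι → F))) (t : Z → F) (ht : ∀ z, t z ≠ 0) (a : Z → GL ι F)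
    (ha : ∀ z, (a z : Matrix ι ι F) = t z • (1 : Matrix ι ι F))
    (hφ : ∀ z, Implements (schrodingerSB (Matrix.toLinearMap₂' F T) ψ hl hbT)
      (ofSymplectic _ (γ⁻¹ * transportSp T hT (levi (a z)) * γ)) (φ z)) :
    ∃ (Φ : ℤ → SchwartzBruhat (ι → F)) (c : Z → ℂ), ∀ n : ℤ, 1 ≤ n →
      (∫ x, ((Φ n : SchwartzBruhat (ι → F)) : (ι → F) → ℂ) x * conj (((Φ n : SchwartzBruhat (ι → F)) : (ι → F) → ℂ) x)
          ∂(Measure.pi fun _ : ι => μ) = (((Measure.pi fun _ : ι => μ).real (piPrimePowBall F ι n) : ℝ) : ℂ)) ∧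
      (∀ z, t z - 1 ∉ primePowBall F n →
        ∫ x, ((φ z (Φ n) : SchwartzBruhat (ι → F)) : (ι → F) → ℂ) x * conj (((Φ n : SchwartzBruhat (ι → F)) : (ι → F) → ℂ) x)
          ∂(Measure.pi fun _ : ι => μ) = 0) ∧
      (∀ z, t z - 1 ∈ primePowBall F n → φ z (Φ n) = c z • Φ n) := by
  haveI : SecondCountableTopology F := secondCountableTopology_localField F
  set ν : Measure (ι → F) := Measure.pi fun _ : ι => μ with hν
  obtain ⟨m, hm⟩ := hψ.exists_hasConductorExp
  obtain ⟨Γ, hΓ, hΓiso⟩ := exists_isometric_implementer_gram T hT hl hbT μ hψ hm γ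
  have hU := implementerUniqueUpToScalar_schrodingerSB_gram T hT hl hbT hψ
  -- the coset-ball vectors and the Levi operators
  set Ψ : ℤ → SchwartzBruhat (ι → F) := fun n =>
    schrodingerSB (Matrix.toLinearMap₂' F T) ψ hl hbT ⟨(-(fun _ : ι => (1 : F)), 0), 0⟩ (piBallSB F ι n) with hΨ_def
  have hΨ : ∀ n, ((Ψ n : SchwartzBruhat (ι → F)) : (ι → F) → ℂ) =
      {u : ι → F | ∀ i, u i - 1 ∈ primePowBall F n}.indicator fun _ => (1 : ℂ) := fun n =>
    coe_schrodingerSB_negOne_piBallSB T hl hbT n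
  set L : Z → (SchwartzBruhat (ι → F) ≃ₗ[ℂ] SchwartzBruhat (ι → F)) := fun z =>
    leviEquivSB (glEquiv (a z)) (glEquiv_continuous (a z)) (glEquiv_symm_continuous (a z)) with hL_def
  -- `N_z = Γ⁻¹ L_z Γ` implements the conjugate torus element; `φ_z = c_z • N_z` by uniqueness
  have hN : ∀ z, Implements (schrodingerSB (Matrix.toLinearMap₂' F T) ψ hl hbT)
      (ofSymplectic _ (γ⁻¹ * transportSp T hT (levi (a z)) * γ)) (Γ⁻¹ * L z * Γ) := fun z => by
    rw [map_mul, map_mul, map_inv]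
    exact Implements.mul _ (Implements.mul _ (Implements.inv _ hΓ) (implements_transportSp_levi T hT hl hbT (a z))) hΓ
  have key : ∀ z, ∃ cz : ℂˣ, ∀ f, φ z f = (cz : ℂ) • (Γ⁻¹ * L z * Γ) f := fun z => hU _ _ _ (hN z) (hφ z)
  choose cu hcu using key
  have hNapply : ∀ z n, (Γ⁻¹ * L z * Γ) (Γ.symm (Ψ n)) = Γ.symm (L z (Ψ n)) := fun z n => by
    rw [LinearEquiv.mul_apply, LinearEquiv.mul_apply, LinearEquiv.apply_symm_apply, LinearEquiv.coe_inv]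
  refine ⟨fun n => Γ.symm (Ψ n), fun z => (cu z : ℂ), fun n hn => ⟨?_, fun z hz => ?_, fun z hz => ?_⟩⟩
  · -- the norm
    rw [integral_mul_conj_symm_eq_of_l2NormSq_eq ν Γ hΓiso (Ψ n) (Ψ n), integral_mul_conj_self_eq_toReal_l2NormSq,
      hΨ_def]
    simp only
    rw [isL2Isometric_schrodingerSB (Matrix.toLinearMap₂' F T) ψ hl hbT ν _ (piBallSB F ι n), l2NormSq_piBallSB_pi μ n,
      measureReal_def]
  · -- the support
    rw [show φ z (Γ.symm (Ψ n)) = (cu z : ℂ) • Γ.symm (L z (Ψ n)) by rw [hcu, hNapply]]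
    have h0 : ∫ x, ((L z (Ψ n) : SchwartzBruhat (ι → F)) : (ι → F) → ℂ) x *
        conj (((Ψ n : SchwartzBruhat (ι → F)) : (ι → F) → ℂ) x) ∂ν = 0 := by
      have hpt : ∀ x, ((L z (Ψ n) : SchwartzBruhat (ι → F)) : (ι → F) → ℂ) x *
          conj (((Ψ n : SchwartzBruhat (ι → F)) : (ι → F) → ℂ) x) = 0 := fun x =>
        leviEquivSB_scalar_apply_mul_conj_eq_zero hn (ht z) hz (ha z) _ _ (Ψ n) (hΨ n) x
      exact (integral_congr_ae (Filter.Eventually.of_forall hpt)).trans (integral_zero _ _)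
    calc ∫ x, ((((cu z : ℂ) • Γ.symm (L z (Ψ n)) : SchwartzBruhat (ι → F)) : (ι → F) → ℂ) x) *
          conj (((Γ.symm (Ψ n) : SchwartzBruhat (ι → F)) : (ι → F) → ℂ) x) ∂ν
        = (cu z : ℂ) * ∫ x, ((Γ.symm (L z (Ψ n)) : SchwartzBruhat (ι → F)) : (ι → F) → ℂ) x *
            conj (((Γ.symm (Ψ n) : SchwartzBruhat (ι → F)) : (ι → F) → ℂ) x) ∂ν := by
          rw [← integral_const_mul]
          refine integral_congr_ae (Filter.Eventually.of_forall fun x => ?_)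
          simp only [Submodule.coe_smul, Pi.smul_apply, smul_eq_mul, mul_assoc]
      _ = 0 := by rw [integral_mul_conj_symm_eq_of_l2NormSq_eq ν Γ hΓiso (L z (Ψ n)) (Ψ n), h0, mul_zero]
  · -- the eigen-equation
    rw [hcu, hNapply, show L z (Ψ n) = Ψ n from
      leviEquivSB_scalar_apply_eq_self_of_sub_one_mem hn hz (ha z) _ _ (Ψ n) (hΨ n)]

end RamifiedTestVector

end Literature.RepresentationTheory.HeisenbergGroup

end
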